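import Mathlib
import HarnessLib
import Summits.HubbardSuperconductivity.HubbardSuperconductivity.Theorems.KLProgrammeKLRegimeSplitTwoLegAngularOfMoments
import Summits.HubbardSuperconductivity.HubbardSuperconductivity.Theorems.KLProgrammePerturbedFermiCurveHigherDerivsRegime
import Summits.HubbardSuperconductivity.HubbardSuperconductivity.Theorems.KLProgrammePerturbedFermiCurveCompChain

/-!
# Route `KLProgramme` — ENGINE child (stmt-HubbardSuperconductivity-19855), two-leg stubs `stub_twoLeg_scale0` / `stub_twoLeg_step`:
# (E3g) `TwoLegAngularG` FROM GRADED MOMENTS of the scale-`n` two-leg data, with the fit against the FROZEN `angBar` DISCHARGED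

Cell `gate-hubbard-kl`, seat hubbard-kl-k3c3-p3 (g3; row «implicit-function / monotonicity route»).  p1b's reduction
`twoLegAngularG_of_moments` (…SplitTwoLegAngularOfMoments) takes ONE constant `m` for the moments of orders `≤ 4` and leaves the fit
`j!·m·Dʲ ≤ angBar G Q R U N j = 4096^{j+1}·angConst^j·|U|·4^{j(N+1)}` as a hypothesis.  With `m` the order-4 moment (`≍ U²·4^{2n}`, BGM
(2.36)) and the curve constant `D = C₀·2^{N+1}` (k3c3-p3 g2, `fermiPointLp_graded_of_frameOK`), the ORDER-ONE fit reads
`U·C₀·2^{3(N+1)} ≲ 4096²·angConst` — false at depth.  This module replaces the single constant by GRADED moments through the structured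
chain rule (`…PerturbedFermiCurveCompChain`, Stirling coefficients `≤ 7`) and then DISCHARGES the fit:

* §1 (model level) `abs_iteratedDeriv_klLocalPart_le_graded`: `‖Dᵏ evalM D_n(K)‖ ≤ m k` (`1 ≤ k ≤ 4`) and `‖γ^{(i)}‖ ≤ Dⁱ` give
  `|∂ʲ ν_n(K)| ≤ 7·(Σ_{k=1}^{j} m k)·Dʲ`; `twoLegAngularG_of_graded_sizes_and_curve` (graded momentum sizes of the interpolant — however
  obtained: moments of the genuine self-energy, frame sizes for the frame vertex `+K` it contains — + curve + graded fit) and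
  `twoLegAngularG_of_graded_moments_and_curve` (graded coefficient moments, p1b's (M1) interface).
* §2 (arithmetic) `graded_fit_angBar`: if `m k ≤ Mtot·U²·2^{k(N+1)}` (`1 ≤ k ≤ 4`), `1 ≤ C₀`, `Mtot·C₀⁴·U ≤ 1`, then
  `7·(Σ_{k≤j} m k)·(C₀·2^{N+1})ʲ ≤ angBar G Q R U N j` for `1 ≤ j ≤ 4` — the spare power of `U` (two-leg data `O(U²)` at orders `≥ 1`,
  `angBar ∝ |U|`) pays every numeral; exponents: `2^{j(N+1)}·2^{j(N+1)} = 4^{j(N+1)}`.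
* §3 (regime) `twoLegAngularG_of_graded_sizes` / `_moments`: for every `R` (`R.WF`) and `Mtot ≥ 0` there are `c₃, U₀ > 0` such that in the KL regime
  (`0 < c ≤ c₃`, `0 < U ≤ U₀`, `klBetaMin ≤ β ≤ e^{c/U²}`), for every `μ ∈ klWindowC`, every admissible frame `FrameOK R U (nScales β) μ K`,
  every volume, every `G, Q` (`WF`) and every scale `n`: graded sizes (resp. coefficient moments) `≤ Mtot·U²·2^{k(nScales β+1)}` of the
  scale-`n` two-leg interpolant ⟹ `TwoLegAngularG L M G Q R β U μ K n`.  NO fit hypothesis is left: (E3g) ⇐ (M1) in graded form.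
  Envelope check (BGM (2.36) accumulated over scales `m ≤ n ≤ N+1`, increments `twoLegBar G Q U k m`): order 1 `Σ 4^{-m} ≤ 4/3`,
  order 2 `≤ N+2 ≤ 4^{N+1}`, order 3 `Σ 4^m ≤ 4^{N+2}/3 ≤ 2·8^{N+1}`, order 4 `Σ 16^m ≤ 16^{N+2}/15` — all `≤ Mtot·2^{k(N+1)}` with
  `Mtot = 2·max_k (S_k + S'_k)` (the engine's choice).

Carrier status (Δ23): reads the frame only through `K : TrigPolyC4v` / `FrameOK` / `klLocalPart` ((I-1) kept) — verbatim under (R-I-min),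
token port under (R-I).  Proofs only; nothing is asserted about the Hubbard model.  References: BGM 2006 §2.4 (2.36), (2.40)
[cite: BenfattoGiulianiMastropietro2006]; HOME/prover-p1b/g6/TWO-LEG-CLOSERS.md §1 row (E3g); HOME/prover-p1b/g5/E3-CERT-NOTE.md §2.
-/

noncomputable section

namespace Summit.HubbardSuperconductivity.HubbardSuperconductivity.Theorems.KLRegimeSplit

set_option linter.dupNamespace false -- summit = problem name (single-conjunct summit), D-0017

open Real Finset
open Literature.MathematicalPhysics.QuantumLattice Literature.Probability.LatticeModels
open Literature.MathematicalPhysics.QuantumLattice.FermiRG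
open Summit.HubbardSuperconductivity.HubbardSuperconductivity.Theorems.KLProgrammeLegKernels
open Summit.HubbardSuperconductivity.HubbardSuperconductivity.Theorems.DispersionFlow
open Summit.HubbardSuperconductivity.HubbardSuperconductivity.Theorems.PerturbedFermiCurve

/-! ## §1 Model level: graded momentum regularity of the two-leg interpolant ⇒ graded angular bounds of the local part -/

section Model

variable {L M : ℕ} [NeZero L] [NeZero M]

/-- **Graded angular derivatives of the local part.**  If `‖Dᵏ evalM (D_n(K))‖ ≤ m k` on `Momentum` for `1 ≤ k ≤ 4` and the Fermi-point
map `γ = toLp ∘ k_F^K` is `C⁴` with `‖γ^{(i)}(θ)‖ ≤ Dⁱ` (`1 ≤ i ≤ 4`), then for `1 ≤ j ≤ 4`: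
`|∂_θʲ ν_n(K)(θ)| ≤ 7·(Σ_{k=1}^{j} m k)·Dʲ` (structured chain rule; the order-`k` size meets curve factors of total order `j` only). -/
theorem abs_iteratedDeriv_klLocalPart_le_graded {β U μ : ℝ} {K : TrigPolyC4v} {n : ℕ} {m : ℕ → ℝ} {D : ℝ}
    (hm : ∀ k, 1 ≤ k → k ≤ 4 → ∀ q : Momentum, ‖iteratedFDeriv ℝ k (evalM (klTwoLegPoly L M β U μ K n)) q‖ ≤ m k)
    (hγ : ContDiff ℝ 4 fun θ => (WithLp.toLp 2 (klFermiPoint μ K θ) : Momentum))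
    (hD : ∀ i, 1 ≤ i → i ≤ 4 → ∀ θ : ℝ,
      ‖iteratedDeriv i (fun θ => (WithLp.toLp 2 (klFermiPoint μ K θ) : Momentum)) θ‖ ≤ D ^ i)
    {j : ℕ} (hj1 : 1 ≤ j) (hj4 : j ≤ 4) (θ : ℝ) :
    |iteratedDeriv j (klLocalPart L M β U μ K n) θ| ≤ 7 * (∑ k ∈ Finset.Icc 1 j, m k) * D ^ j := by
  rw [klLocalPart_eq_comp]
  exact abs_iteratedDeriv_comp_le_envelope (contDiff_evalM _) hγ (fun k hk1 hk4 => hm k hk1 hk4 _)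
    (fun i hi1 hi4 => hD i hi1 hi4 θ) hj1 hj4

/-- **(E3g) FROM GRADED SIZES AND THE CURVE.**  Momentum derivatives of the two-leg interpolant `‖Dᵏ evalM D_n(K)‖ ≤ m k`
(`1 ≤ k ≤ 4`, however obtained: coefficient moments of the genuine self-energy, frame sizes for the frame vertex it contains, …), the
Fermi-point map `C⁴` with `‖γ^{(i)}‖ ≤ Dⁱ` (`1 ≤ i ≤ 4`), and the GRADED fit `7·(Σ_{k≤j} m k)·Dʲ ≤ angBar G Q R U (nScales β) j` (`1 ≤ j ≤ 4`)
give `TwoLegAngularG … K n`. -/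
theorem twoLegAngularG_of_graded_sizes_and_curve {G : GeoConsts} {Q : EngConsts} {R : RenConsts} {β U μ : ℝ} {K : TrigPolyC4v}
    {n : ℕ} {m : ℕ → ℝ} {D : ℝ}
    (hm : ∀ k, 1 ≤ k → k ≤ 4 → ∀ q : Momentum, ‖iteratedFDeriv ℝ k (evalM (klTwoLegPoly L M β U μ K n)) q‖ ≤ m k)
    (hγ : ContDiff ℝ 4 fun θ => (WithLp.toLp 2 (klFermiPoint μ K θ) : Momentum))
    (hD : ∀ i, 1 ≤ i → i ≤ 4 → ∀ θ : ℝ,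
      ‖iteratedDeriv i (fun θ => (WithLp.toLp 2 (klFermiPoint μ K θ) : Momentum)) θ‖ ≤ D ^ i)
    (hfit : ∀ j, 1 ≤ j → j ≤ 4 → 7 * (∑ k ∈ Finset.Icc 1 j, m k) * D ^ j ≤ angBar G Q R U (nScales β) j) :
    TwoLegAngularG L M G Q R β U μ K n := by
  refine ⟨?_, fun j hj1 hj4 θ => ?_⟩
  · rw [klLocalPart_eq_comp]
    exact (contDiff_evalM _).comp hγ
  · exact (abs_iteratedDeriv_klLocalPart_le_graded hm hγ hD hj1 hj4 θ).trans (hfit j hj1 hj4)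

/-- **(E3g) FROM GRADED MOMENTS AND THE CURVE.**  Coefficient moments of the scale-`n` two-leg data of orders `1 ≤ k ≤ 4` bounded by
`m k`, the Fermi-point map `C⁴` with `‖γ^{(i)}‖ ≤ Dⁱ` (`1 ≤ i ≤ 4`), and the GRADED fit `7·(Σ_{k≤j} m k)·Dʲ ≤ angBar G Q R U (nScales β) j`
(`1 ≤ j ≤ 4`) give `TwoLegAngularG … K n` (p1b's `twoLegAngularG_of_moments_and_curve` with one constant per order). -/
theorem twoLegAngularG_of_graded_moments_and_curve {G : GeoConsts} {Q : EngConsts} {R : RenConsts} {β U μ : ℝ} {K : TrigPolyC4v}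
    {n : ℕ} {m : ℕ → ℝ} {D : ℝ}
    (hm : ∀ k, 1 ≤ k → k ≤ 4 → ∑ x : TorusSite 2 L, (1 + (x 0).valMinAbs.natAbs + (x 1).valMinAbs.natAbs : ℝ) ^ k *
      |torusCosCoeff L (klLocSelfEnergyRe L M β U μ K n) x| ≤ m k)
    (hγ : ContDiff ℝ 4 fun θ => (WithLp.toLp 2 (klFermiPoint μ K θ) : Momentum))
    (hD : ∀ i, 1 ≤ i → i ≤ 4 → ∀ θ : ℝ,
      ‖iteratedDeriv i (fun θ => (WithLp.toLp 2 (klFermiPoint μ K θ) : Momentum)) θ‖ ≤ D ^ i)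
    (hfit : ∀ j, 1 ≤ j → j ≤ 4 → 7 * (∑ k ∈ Finset.Icc 1 j, m k) * D ^ j ≤ angBar G Q R U (nScales β) j) :
    TwoLegAngularG L M G Q R β U μ K n :=
  twoLegAngularG_of_graded_sizes_and_curve
    (fun k hk1 hk4 q => norm_iteratedFDeriv_evalM_klTwoLegPoly_le_of_moments (hm k hk1 hk4) q) hγ hD hfit

end Model

/-! ## §2 Arithmetic: the graded fit against the frozen `angBar` -/

/-- `Σ_{k=1}^{j} m k ≤ 4·Mtot·U²·2^{j(N+1)}` for `j ≤ 4` when `m k ≤ Mtot·U²·2^{k(N+1)}`. -/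
theorem sum_graded_moments_le {m : ℕ → ℝ} {Mtot U : ℝ} (hMtot : 0 ≤ Mtot) {N : ℕ}
    (hm : ∀ k, 1 ≤ k → k ≤ 4 → m k ≤ Mtot * U ^ 2 * (2 : ℝ) ^ (k * (N + 1))) {j : ℕ} (hj4 : j ≤ 4) :
    ∑ k ∈ Finset.Icc 1 j, m k ≤ 4 * (Mtot * U ^ 2 * (2 : ℝ) ^ (j * (N + 1))) := by
  have hle : ∀ k ∈ Finset.Icc 1 j, m k ≤ Mtot * U ^ 2 * (2 : ℝ) ^ (j * (N + 1)) := by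
    intro k hk
    rw [Finset.mem_Icc] at hk
    refine (hm k hk.1 (hk.2.trans hj4)).trans ?_
    have h2 : (2 : ℝ) ^ (k * (N + 1)) ≤ (2 : ℝ) ^ (j * (N + 1)) :=
      pow_le_pow_right₀ (by norm_num) (Nat.mul_le_mul_right _ hk.2)
    have : 0 ≤ Mtot * U ^ 2 := mul_nonneg hMtot (sq_nonneg U)
    exact mul_le_mul_of_nonneg_left h2 this
  refine (Finset.sum_le_sum hle).trans ?_
  rw [Finset.sum_const, Nat.card_Icc, nsmul_eq_mul]
  have hpos : 0 ≤ Mtot * U ^ 2 * (2 : ℝ) ^ (j * (N + 1)) := by positivity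
  have hj : ((j + 1 - 1 : ℕ) : ℝ) ≤ 4 := by
    rw [Nat.add_sub_cancel]; exact_mod_cast hj4
  exact mul_le_mul_of_nonneg_right hj hpos

/-- **The graded fit.**  With `m k ≤ Mtot·U²·2^{k(N+1)}` (`1 ≤ k ≤ 4`), `0 < U`, `1 ≤ C₀` and the smallness `Mtot·C₀⁴·U ≤ 1`:
`7·(Σ_{k≤j} m k)·(C₀·2^{N+1})ʲ ≤ angBar G Q R U N j` for `1 ≤ j ≤ 4` — the two powers of `2^{j(N+1)}` make `angBar`'s `4^{j(N+1)}`,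
and `28·Mtot·U²·C₀ʲ ≤ 28·U ≤ 4096·|U| ≤ klAngKappa^{j+1}·angConst^j·|U|`. -/
theorem graded_fit_angBar {G : GeoConsts} {Q : EngConsts} {R : RenConsts} (hG : G.WF) (hQ : Q.WF) (hR : R.WF) {U : ℝ} (hU : 0 < U)
    {C₀ Mtot : ℝ} (hC₀ : 1 ≤ C₀) (hMtot : 0 ≤ Mtot) (hsmall : Mtot * C₀ ^ 4 * U ≤ 1) (N : ℕ) {m : ℕ → ℝ}
    (hm : ∀ k, 1 ≤ k → k ≤ 4 → m k ≤ Mtot * U ^ 2 * (2 : ℝ) ^ (k * (N + 1))) {j : ℕ} (hj1 : 1 ≤ j) (hj4 : j ≤ 4) :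
    7 * (∑ k ∈ Finset.Icc 1 j, m k) * (C₀ * (2 : ℝ) ^ (N + 1)) ^ j ≤ angBar G Q R U N j := by
  have hS := sum_graded_moments_le hMtot hm hj4
  have hC1j : 1 ≤ C₀ ^ j := one_le_pow₀ hC₀
  have hCj4 : C₀ ^ j ≤ C₀ ^ 4 := pow_le_pow_right₀ hC₀ hj4
  have hA1 : 1 ≤ angConst G Q R U := one_le_angConst hG hQ hR U
  have hAj : 1 ≤ angConst G Q R U ^ j := one_le_pow₀ hA1
  have hκ : (4096 : ℝ) ≤ klAngKappa ^ (j + 1) := by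
    unfold klAngKappa
    calc (4096 : ℝ) = 4096 ^ 1 := (pow_one _).symm
      _ ≤ 4096 ^ (j + 1) := pow_le_pow_right₀ (by norm_num) (by omega)
  have hT : 0 ≤ (2 : ℝ) ^ (j * (N + 1)) := by positivity
  have h22 : ((2 : ℝ) ^ (N + 1)) ^ j * (2 : ℝ) ^ (j * (N + 1)) = (4 : ℝ) ^ (j * (N + 1)) := by
    rw [← pow_mul, mul_comm (N + 1) j, ← pow_add, ← two_mul, pow_mul]; norm_num
  have hU2 : U ^ 2 = U * U := sq U
  have habs : |U| = U := abs_of_pos hU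
  -- LHS ≤ 28·Mtot·U²·2^{j(N+1)}·C₀^j·2^{j(N+1)} = 28·Mtot·U²·C₀^j·4^{j(N+1)}
  have hL : 7 * (∑ k ∈ Finset.Icc 1 j, m k) * (C₀ * (2 : ℝ) ^ (N + 1)) ^ j ≤
      28 * Mtot * U ^ 2 * C₀ ^ j * (4 : ℝ) ^ (j * (N + 1)) := by
    have hP : 0 ≤ (C₀ * (2 : ℝ) ^ (N + 1)) ^ j := by positivity
    calc 7 * (∑ k ∈ Finset.Icc 1 j, m k) * (C₀ * (2 : ℝ) ^ (N + 1)) ^ j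
        ≤ 7 * (4 * (Mtot * U ^ 2 * (2 : ℝ) ^ (j * (N + 1)))) * (C₀ * (2 : ℝ) ^ (N + 1)) ^ j := by
          exact mul_le_mul_of_nonneg_right (by linarith) hP
      _ = 28 * Mtot * U ^ 2 * C₀ ^ j * (((2 : ℝ) ^ (N + 1)) ^ j * (2 : ℝ) ^ (j * (N + 1))) := by rw [mul_pow]; ring
      _ = 28 * Mtot * U ^ 2 * C₀ ^ j * (4 : ℝ) ^ (j * (N + 1)) := by rw [h22]
  -- 28·Mtot·U²·C₀^j ≤ 28·U·(Mtot·C₀⁴·U) ≤ 28·U ≤ 4096·angConst^j·|U|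
  have hmid : 28 * Mtot * U ^ 2 * C₀ ^ j ≤ klAngKappa ^ (j + 1) * angConst G Q R U ^ j * |U| := by
    rw [habs]
    have h1 : Mtot * U ^ 2 * C₀ ^ j ≤ Mtot * U ^ 2 * C₀ ^ 4 :=
      mul_le_mul_of_nonneg_left hCj4 (mul_nonneg hMtot (sq_nonneg U))
    have h2 : Mtot * U ^ 2 * C₀ ^ 4 = (Mtot * C₀ ^ 4 * U) * U := by ring
    have h3 : (Mtot * C₀ ^ 4 * U) * U ≤ 1 * U := mul_le_mul_of_nonneg_right hsmall hU.le
    have h4 : (4096 : ℝ) * 1 * U ≤ klAngKappa ^ (j + 1) * angConst G Q R U ^ j * U := by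
      gcongr
    nlinarith
  unfold angBar
  calc _ ≤ 28 * Mtot * U ^ 2 * C₀ ^ j * (4 : ℝ) ^ (j * (N + 1)) := hL
    _ ≤ klAngKappa ^ (j + 1) * angConst G Q R U ^ j * |U| * (4 : ℝ) ^ (j * (N + 1)) :=
        mul_le_mul_of_nonneg_right hmid (by positivity)

/-! ## §3 Regime level: (E3g) from graded sizes / graded moments alone -/

/-- **(E3g) IN THE KL REGIME FROM GRADED SIZES, FIT DISCHARGED.**  For every `R` (`R.WF`) and every `Mtot ≥ 0` there are `c₃, U₀ > 0`
such that for `0 < c ≤ c₃`, `0 < U ≤ U₀`, `klBetaMin ≤ β ≤ e^{c/U²}`, every `μ ∈ klWindowC`, every admissible frame `FrameOK R U (nScales β) μ K`,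
every volume `(L, M)`, all well-formed `G, Q` and every scale `n`: if the momentum derivatives of the scale-`n` two-leg interpolant satisfy
`‖Dᵏ evalM D_n(K)‖ ≤ Mtot·U²·2^{k(nScales β+1)}` for `1 ≤ k ≤ 4`, then `TwoLegAngularG L M G Q R β U μ K n` — no fit hypothesis left.
(`U₀ = min(U₀^{curve}(R), U₀^{C4}(R), 1/(Mtot·C₀(R)⁴+1))`, `C₀(R)` the graded curve constant of `fermiPointLp_graded_of_frameOK`.) -/
theorem twoLegAngularG_of_graded_sizes (R : RenConsts) (hR : R.WF) (Mtot : ℝ) (hMtot : 0 ≤ Mtot) :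
    ∃ c₃ : ℝ, 0 < c₃ ∧ ∃ U₀ : ℝ, 0 < U₀ ∧
      ∀ c : ℝ, 0 < c → c ≤ c₃ → ∀ U : ℝ, 0 < U → U ≤ U₀ → ∀ β : ℝ, klBetaMin ≤ β → β ≤ Real.exp (c / U ^ 2) →
      ∀ μ ∈ klWindowC, ∀ K : TrigPolyC4v, FrameOK R U (nScales β) μ K →
        ∀ (L M : ℕ) [NeZero L] [NeZero M] (G : GeoConsts) (Q : EngConsts), G.WF → Q.WF → ∀ n : ℕ,
          (∀ k, 1 ≤ k → k ≤ 4 → ∀ q : Momentum,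
              ‖iteratedFDeriv ℝ k (evalM (klTwoLegPoly L M β U μ K n)) q‖ ≤ Mtot * U ^ 2 * (2 : ℝ) ^ (k * (nScales β + 1))) →
          TwoLegAngularG L M G Q R β U μ K n := by
  have hGfr : ∀ j, 0 ≤ R.Gfr j := hR.2.2
  obtain ⟨c₃, hc₃, U₀, hU₀, C₀, hC₀, hcurve⟩ := fermiPointLp_graded_of_frameOK R hGfr
  obtain ⟨c₃', hc₃', U₀', hU₀', hC4⟩ := fermiPointLp_C4_of_frameOK R hGfr
  have hden : 0 < Mtot * C₀ ^ 4 + 1 := by positivity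
  refine ⟨min c₃ c₃', lt_min hc₃ hc₃', min (min U₀ U₀') (1 / (Mtot * C₀ ^ 4 + 1)),
    lt_min (lt_min hU₀ hU₀') (by positivity), ?_⟩
  intro c hc hcle U hU hUle β hβ hβc μ hμ K hK L M _ _ G Q hG hQ n hm
  have hc1 : c ≤ c₃ := hcle.trans (min_le_left _ _)
  have hc2 : c ≤ c₃' := hcle.trans (min_le_right _ _)
  have hU1 : U ≤ U₀ := hUle.trans ((min_le_left _ _).trans (min_le_left _ _))
  have hU2 : U ≤ U₀' := hUle.trans ((min_le_left _ _).trans (min_le_right _ _))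
  have hU3 : U ≤ 1 / (Mtot * C₀ ^ 4 + 1) := hUle.trans (min_le_right _ _)
  have hsmall : Mtot * C₀ ^ 4 * U ≤ 1 := by
    have h0 : 0 ≤ Mtot * C₀ ^ 4 := by positivity
    calc Mtot * C₀ ^ 4 * U ≤ Mtot * C₀ ^ 4 * (1 / (Mtot * C₀ ^ 4 + 1)) := mul_le_mul_of_nonneg_left hU3 h0
      _ = Mtot * C₀ ^ 4 / (Mtot * C₀ ^ 4 + 1) := by ring
      _ ≤ 1 := by rw [div_le_one hden]; linarith
  obtain ⟨D', -, hD'⟩ := hC4 c hc hc2 U hU hU2 β hβ hβc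
  obtain ⟨hγ, -⟩ := hD' μ hμ K hK
  have hD : ∀ i, 1 ≤ i → i ≤ 4 → ∀ θ : ℝ,
      ‖iteratedDeriv i (fun θ : ℝ => (WithLp.toLp 2 (klFermiPoint μ K θ) : Momentum)) θ‖ ≤
        (C₀ * (2 : ℝ) ^ (nScales β + 1)) ^ i := by
    intro i hi1 hi4 θ
    rw [← norm_iteratedFDeriv_eq_norm_iteratedDeriv]
    exact hcurve c hc hc1 U hU hU1 β hβ hβc μ hμ K hK i hi1 hi4 θ
  exact twoLegAngularG_of_graded_sizes_and_curve
    (m := fun k => Mtot * U ^ 2 * (2 : ℝ) ^ (k * (nScales β + 1))) hm hγ hD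
    fun j hj1 hj4 => graded_fit_angBar hG hQ hR hU hC₀ hMtot hsmall (nScales β) (fun k _ _ => le_rfl) hj1 hj4

/-- **(E3g) IN THE KL REGIME FROM GRADED MOMENTS, FIT DISCHARGED** (the (M1) interface of HOME/prover-p1b/g6/TWO-LEG-CLOSERS.md, one
majorant per order): same thresholds; if the coefficient moments of orders `1 ≤ k ≤ 4` of the scale-`n` two-leg data are
`≤ Mtot·U²·2^{k(nScales β+1)}`, then `TwoLegAngularG L M G Q R β U μ K n`. -/
theorem twoLegAngularG_of_graded_moments (R : RenConsts) (hR : R.WF) (Mtot : ℝ) (hMtot : 0 ≤ Mtot) :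
    ∃ c₃ : ℝ, 0 < c₃ ∧ ∃ U₀ : ℝ, 0 < U₀ ∧
      ∀ c : ℝ, 0 < c → c ≤ c₃ → ∀ U : ℝ, 0 < U → U ≤ U₀ → ∀ β : ℝ, klBetaMin ≤ β → β ≤ Real.exp (c / U ^ 2) →
      ∀ μ ∈ klWindowC, ∀ K : TrigPolyC4v, FrameOK R U (nScales β) μ K →
        ∀ (L M : ℕ) [NeZero L] [NeZero M] (G : GeoConsts) (Q : EngConsts), G.WF → Q.WF → ∀ n : ℕ,
          (∀ k, 1 ≤ k → k ≤ 4 → ∑ x : TorusSite 2 L, (1 + (x 0).valMinAbs.natAbs + (x 1).valMinAbs.natAbs : ℝ) ^ k *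
              |torusCosCoeff L (klLocSelfEnergyRe L M β U μ K n) x| ≤ Mtot * U ^ 2 * (2 : ℝ) ^ (k * (nScales β + 1))) →
          TwoLegAngularG L M G Q R β U μ K n := by
  obtain ⟨c₃, hc₃, U₀, hU₀, h⟩ := twoLegAngularG_of_graded_sizes R hR Mtot hMtot
  refine ⟨c₃, hc₃, U₀, hU₀, fun c hc hcle U hU hUle β hβ hβc μ hμ K hK L M _ _ G Q hG hQ n hm => ?_⟩
  exact h c hc hcle U hU hUle β hβ hβc μ hμ K hK L M G Q hG hQ n
    fun k hk1 hk4 q => norm_iteratedFDeriv_evalM_klTwoLegPoly_le_of_moments (hm k hk1 hk4) q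

end Summit.HubbardSuperconductivity.HubbardSuperconductivity.Theorems.KLRegimeSplit

end
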